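import Mathlib
import Literature.Computability.AlgebraicComplexity.LinSubst
import Literature.Barriers.ValiantsHypothesis.ShiftedPartialsMonotone

/-!
# Border apolarity, crux `ToricWitnessObstructionQP` — stub `stub_lieIdentity` (S1, the Lie identity)

Route `ValiantsHypothesis/BorderApolarity`, crux item `stmt-ValiantsHypothesis-14753`, line `Sketch`,
stub `stub_lieIdentity`.  Euler's weighted identity `∑ k, w k • (X k * ∂_k G) = e • G` for a
`w`-weighted homogeneous polynomial `G` of weight `e` (Mathlib's
`MvPolynomial.IsWeightedHomogeneous.sum_weight_X_mul_pderiv`), transported through the linear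
substitution of variables by an invertible matrix `u` (`linSubst`, `X i ↦ ∑ j, u j i • X j`): for
`P = u · G` and `N = u · diag(w) · u⁻¹` one has `∑_{i,j} N_{ji} X_j ∂_i P = e · P`.  This is the
infinitesimal shadow of the fact that the one-parameter torus `s ↦ u · diag(s ^ w) · u⁻¹` rescales
`P` by `s ^ e`.

Proof: the chain rule `∂_i (u · G) = ∑ k, u i k • u · (∂_k G)` (`pderiv_linSubst`) re-indexes the
Lie operator of any matrix `M` on `u · G` as `∑_{j,k} (M u)_{jk} X_j (u · ∂_k G)`; for `M = N` the
matrix `N u = u · diag(w)` has entries `u j k * w k`, and `∑_j u j k • X j = u · X_k`, so the sum is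
`u · (∑ k, w k • X_k ∂_k G) = u · (e • G) = e • (u · G)` since `linSubst` is an algebra map.
-/

open MvPolynomial
open scoped BigOperators Matrix
open Literature.Computability.AlgebraicComplexity

-- the mandated summit-side namespace repeats a component by design (single-problem summit)
set_option linter.dupNamespace false

namespace Summit.ValiantsHypothesis.ValiantsHypothesis.Theorems.BorderApolarityToricWitnessObstructionQP

/-- **Chain-rule re-indexing of a Lie operator.**  For matrices `M`, `A` and a polynomial `G`,
`∑_{i,j} M_{ji} X_j ∂_i (A · G) = ∑_{j,k} (M A)_{jk} X_j (A · ∂_k G)`, by the chain rule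
`∂_i (A · G) = ∑ k, A i k • A · (∂_k G)`. [folklore] -/
theorem sum_smul_X_mul_pderiv_linSubst {σ : Type*} [Fintype σ] [DecidableEq σ]
    (M A : Matrix σ σ ℂ) (G : MvPolynomial σ ℂ) :
    ∑ i, ∑ j, M j i • (X j * pderiv i (linSubst σ ℂ A G)) =
      ∑ j, ∑ k, (M * A) j k • (X j * linSubst σ ℂ A (pderiv k G)) := by
  simp_rw [Literature.Barriers.ValiantsHypothesis.pderiv_linSubst, Matrix.mul_apply,
    Finset.sum_smul, Finset.mul_sum, Finset.smul_sum, mul_smul_comm, smul_smul]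
  -- LHS : `∑ i, ∑ j, ∑ k, (M j i * A i k) • (X j * A·(∂k G))`
  -- RHS : `∑ j, ∑ k, ∑ i, (M j i * A i k) • (X j * A·(∂k G))`
  conv_lhs => rw [Finset.sum_comm]
  exact Finset.sum_congr rfl fun j _ => Finset.sum_comm

/-- **Euler's weighted identity transported through a linear substitution.**  For `G`
`w`-weighted homogeneous of weight `e` and any matrix `A`,
`∑_{j,k} (A · diag(w))_{jk} X_j (A · ∂_k G) = e • (A · G)`: apply the algebra map `linSubst A` to
`∑ k, w k • X_k ∂_k G = e • G` and expand `A · X_k = ∑ j, A j k • X j`. [folklore] -/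
theorem sum_smul_X_mul_linSubst_pderiv_eq {σ : Type*} [Fintype σ] [DecidableEq σ]
    (A : Matrix σ σ ℂ) (w : σ → ℕ) (e : ℕ) (G : MvPolynomial σ ℂ)
    (hG : IsWeightedHomogeneous w G e) :
    ∑ j, ∑ k, (A * Matrix.diagonal (fun k => (w k : ℂ))) j k • (X j * linSubst σ ℂ A (pderiv k G)) =
      (e : ℂ) • linSubst σ ℂ A G := by
  have hE := congrArg (linSubst σ ℂ A) hG.sum_weight_X_mul_pderiv
  rw [map_nsmul, ← Nat.cast_smul_eq_nsmul ℂ, map_sum] at hE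
  rw [← hE]
  simp_rw [map_nsmul, ← Nat.cast_smul_eq_nsmul ℂ, map_mul, linSubst_X, Finset.sum_mul,
    Finset.smul_sum, smul_mul_assoc, smul_smul, Matrix.mul_diagonal]
  -- LHS : `∑ j, ∑ k, (A j k * w k) • (X j * A·(∂k G))`
  -- RHS : `∑ k, ∑ j, (w k * A j k) • (X j * A·(∂k G))`
  conv_lhs => rw [Finset.sum_comm]
  exact Finset.sum_congr rfl fun k _ => Finset.sum_congr rfl fun j _ => by rw [mul_comm]

/-- **S1 (Lie identity).** Euler's identity for a `w`-weighted homogeneous `G` of weight `e`,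
transported through the substitution `u`: for `P = u · G` and `N = u · diag(w) · u⁻¹`,
`Σ_{i,j} N_{ji} X_j ∂_i P = e · P`. [folklore] -/
theorem stub_lieIdentity : ∀ (σ : Type) [Fintype σ] [DecidableEq σ] (u : GL σ ℂ) (w : σ → ℕ) (e : ℕ)
    (G P : MvPolynomial σ ℂ), IsWeightedHomogeneous w G e →
    P = linSubst σ ℂ (u : Matrix σ σ ℂ) G →
    ∑ i, ∑ j, ((u : Matrix σ σ ℂ) * Matrix.diagonal (fun k => (w k : ℂ)) *
        ((u⁻¹ : GL σ ℂ) : Matrix σ σ ℂ)) j i • (X j * pderiv i P) = (e : ℂ) • P := by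
  intro σ _ _ u w e G P hG hP
  subst hP
  have hinv : ((u⁻¹ : GL σ ℂ) : Matrix σ σ ℂ) * (u : Matrix σ σ ℂ) = 1 := u.inv_mul
  rw [sum_smul_X_mul_pderiv_linSubst]
  simp only [Matrix.mul_assoc, hinv, Matrix.mul_one]
  exact sum_smul_X_mul_linSubst_pderiv_eq _ w e G hG

end Summit.ValiantsHypothesis.ValiantsHypothesis.Theorems.BorderApolarityToricWitnessObstructionQP
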